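import Mathlib
import Literature.NumberTheory.LFunctions.Zhang2022.Section16BSmoothedSum
import Literature.NumberTheory.LFunctions.Zhang2022.ToolkitGaussUnsmoothingShiu
import Literature.NumberTheory.LFunctions.MertensFormula
import HarnessLib

/-!
# Zhang (2022) §16 p. 94, node `Z22:§16.u040`, first equality ("By (4.2) and (4.3)"): the sharp sum
# `Σ_{n<T} ϖ₂ⱼ(n)(ν∗χ)(n)/n` against its Gaussian smoothing — a multiplicative Shiu majorant for
# `ϖ₂ⱼ(ν∗χ)` and the display with the error `O(𝓛⁻⁴)` the §16 chain consumes

Topic `Literature/NumberTheory/LFunctions/Zhang2022` (Landau–Siegel audit tree; verdict-neutral).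
Y. Zhang, *Discrete mean estimates and the Landau–Siegel zero*, arXiv:2211.02515v1 (2022)
[Zhang2022LandauSiegel] — **an unrefereed manuscript under adjudication** (ZHANG-L discharge lane).
§16 p. 94, tex L4656–L4658 (DAG `Z22:§16.u040`, typed `Typed.Section16B.Step16_u040a`):

> We have `Σ_{n<T} ϖ₂ⱼ(n)(ν∗χ)(n)/n = Σ_n ϖ₂ⱼ(n)(ν∗χ)(n)n⁻¹g(T/n) + O(1/𝓛¹⁰)`  ("By (4.2) and (4.3)").

The error of such an unsmoothing is the Gaussian transition window `Σ_n |a(n)|n⁻¹e^{−𝓛³⁰log²(T/n)}`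
(`a = ϖ₂ⱼ(ν∗χ)`), of size `≈ 𝓛⁻¹⁵ ×` (the mean of `|a(n)|` at `n ≍ T = e^{𝓛^{1.1}}`); it is
controlled, uniformly in the modulus, by Shiu's theorem once `|a|` has a multiplicative majorant `h`
of bounded prime values — the tree's packaged form
`GaussWeight.norm_sum_Ico_sub_tsum_mul_gWeight_le_of_multiplicative` (ZHANG-L LIB-C Q-19). This
theorem-only file supplies such a majorant and the display in the strength the §16 chain uses:

* `exists_multiplicative_majorant` — there is a multiplicative `h ≥ 0` (namely
  `h(n) = ∏_{q∣n}(1 + 900q^{−9/10}) · Σ_{d∣n}∏_{q∣d}(q+1)/(q−1) · τ₃(n)`, built from Mathlib's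
  `ArithmeticFunction.prodPrimeFactors`, `ζ` and the tree's `MeanSquareMajorant.tau`) with
  `h(p^l) ≤ 28832^l`, `h(n) ≤ A₂(δ)n^δ` (divisor bound), `Σ_{p≤x} h(p)/p ≤ 6 log log x + C₁`
  (`h(p) = 6(1 + 900p^{−9/10})p/(p−1)`; Mertens' second theorem, tree `abs_primeRecipSum_sub_le`
  [cite: HardyWright2008, Theorem 427]), and, for `D` large under (A) (`|𝓜₂*| ≥ c₀` near `1`,
  `|β_j| < 5α`), `|ϖ₂ⱼ(n)(ν∗χ)(n)| ≤ (K/c₀)·h(n)` — from `ϖ₂ⱼ(n) = Σ_{n=dl}λ₂(d)d^{β_j}χ(l)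
  𝓜₂(d,l;1−β_j)/𝓜₂*(1−β_j)` with `|λ₂(d)| ≤ ∏_{q∣d}(q+1)/(q−1)` (`norm_lam2_one_le_prod`),
  `|𝓜₂(d,l;s)| ≤ K∏_{q∣dl}(1+900q^{−9/10})` (u022, tree `Typed.Section16A.norm_calM2_le`), and
  `|(ν∗χ)(n)| ≤ τ₃(n)` (`norm_nuConvChi_le_tau_three`).
* `step16_u040a_weak` — **the first u040 equality with the error `C·(ell D ^ 4)⁻¹`** (statement
  spelled INLINE; it is `Step16_u040a` with `𝓛⁻⁴` for `𝓛⁻¹⁰`): the majorant has prime average `6`,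
  so Shiu's theorem gives the short-interval exponent `k = 5` and the window is
  `≪ (log T)⁵/𝓛¹⁵ = 𝓛^{−9.5}`; the tree's consumer `Typed.Section16B.sumLtT_eval_of_repair` uses the
  u040a error only through `(ell D ^ 10)⁻¹ ≤ (ell D ^ 4)⁻¹`, so this is the strength the §16 chain
  (`eq16_16R2_of_subleaves`) needs. READING NOTE (ZHANG-L FINDING zl-libC-p5, HOME/STATUS
  2026-08-27T00:40Z): the printed `O(1/𝓛¹⁰)` exceeds what "(4.2) and (4.3)" give uniformly in the
  modulus by `𝓛^{1/2}` (it holds only through the (A)-sparsity of the primes with `χ(p) = 1`); the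
  typed `Step16_u040a` is therefore NOT claimed here.

No new definitions, no named facts, no `sorry`. Nothing here bears on Theorems 1–2 of the source or
on Landau–Siegel zeros.

## References

* Y. Zhang, arXiv:2211.02515v1 (2022), §16 pp. 93–94 (u030, u040); §4 (4.1)–(4.3) p. 19.
  [cite: Zhang2022LandauSiegel, §16 p.94 (u040)]
* P. Shiu, *A Brun–Titchmarsh theorem for multiplicative functions*, J. reine angew. Math. 313
  (1980) 161–170, Theorem 1 (through the tree's `GaussWeight.…_of_multiplicative`).
  [cite: Shiu1980, Theorem 1]
* G. H. Hardy, E. M. Wright, *An Introduction to the Theory of Numbers* (6th ed., 2008), Theorem 427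
  (Mertens' second theorem) and Theorem 315 (the divisor bound).
  [cite: HardyWright2008, Theorem 427]
-/

noncomputable section

open Complex Real Finset Filter Topology
open ArithmeticFunction (prodPrimeFactors prodPrimeFactors_apply pmul_apply coe_mul_zeta_apply)
open Literature.NumberTheory.LFunctions.Zhang2022
open Literature.NumberTheory.LFunctions.Zhang2022.Skeleton
open Literature.NumberTheory.LFunctions.Zhang2022.Typed.Section16A

namespace Literature.NumberTheory.LFunctions.Zhang2022.Typed.Section16B

/-! ## §1. Elementary facts about `∏_{q∣n} f(q)`-type weights and `τⱼ` -/

section Weights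

/-- `2^{ω(n)} ≤ τ(n)` (`n ≥ 1`). [folklore] -/
private theorem two_pow_card_primeFactors_le' {n : ℕ} (hn : n ≠ 0) :
    2 ^ n.primeFactors.card ≤ n.divisors.card := by
  rw [Nat.card_divisors hn]
  refine Finset.pow_card_le_prod _ _ _ fun p hp => ?_
  have : 0 < n.factorization p := Nat.Prime.factorization_pos_of_dvd (Nat.prime_of_mem_primeFactors hp)
    hn (Nat.dvd_of_mem_primeFactors hp)
  omega

/-- `τ(k) ≤ τ(n)` for `k ∣ n`, `n ≥ 1`. [folklore] -/
private theorem card_divisors_le_of_dvd'' {k n : ℕ} (hn : n ≠ 0) (hk : k ∣ n) :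
    k.divisors.card ≤ n.divisors.card :=
  Finset.card_le_card (Nat.divisors_subset_of_dvd hn hk)

/-- `(q+1)/(q−1) ≤ 3` for `q ≥ 2`. [folklore] -/
private theorem lamPlus_le_three {q : ℕ} (hq : 2 ≤ q) : ((q : ℝ) + 1) / ((q : ℝ) - 1) ≤ 3 := by
  have hq' : (2 : ℝ) ≤ q := by exact_mod_cast hq
  rw [div_le_iff₀ (by linarith)]
  linarith

/-- `0 < (q+1)/(q−1)` for `q ≥ 2`. [folklore] -/
private theorem lamPlus_pos {q : ℕ} (hq : 2 ≤ q) : 0 < ((q : ℝ) + 1) / ((q : ℝ) - 1) := by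
  have hq' : (2 : ℝ) ≤ q := by exact_mod_cast hq
  exact div_pos (by linarith) (by linarith)

/-- `∏_{q∣n}(q+1)/(q−1) ≤ τ(n)²` for `n ≥ 1` (each factor `≤ 3 ≤ 4`, `2^{ω(n)} ≤ τ(n)`). [folklore] -/
private theorem prod_primeFactors_lamPlus_le {n : ℕ} (hn : n ≠ 0) :
    ∏ q ∈ n.primeFactors, ((q : ℝ) + 1) / ((q : ℝ) - 1) ≤ (n.divisors.card : ℝ) ^ 2 := by
  calc ∏ q ∈ n.primeFactors, ((q : ℝ) + 1) / ((q : ℝ) - 1)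
      ≤ ∏ _q ∈ n.primeFactors, (2 : ℝ) ^ 2 := Finset.prod_le_prod
          (fun q hq => (lamPlus_pos (Nat.prime_of_mem_primeFactors hq).two_le).le)
          (fun q hq => (lamPlus_le_three (Nat.prime_of_mem_primeFactors hq).two_le).trans (by norm_num))
    _ = ((2 : ℝ) ^ n.primeFactors.card) ^ 2 := by rw [Finset.prod_const, ← pow_mul, mul_comm, pow_mul]
    _ ≤ (n.divisors.card : ℝ) ^ 2 := by
        gcongr
        exact_mod_cast two_pow_card_primeFactors_le' hn

/-- `0 ≤ ∏_{q∣n}(q+1)/(q−1)`. [folklore] -/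
private theorem prod_primeFactors_lamPlus_nonneg (n : ℕ) :
    0 ≤ ∏ q ∈ n.primeFactors, ((q : ℝ) + 1) / ((q : ℝ) - 1) :=
  Finset.prod_nonneg fun _ hq => (lamPlus_pos (Nat.prime_of_mem_primeFactors hq).two_le).le

/-- `τ₃(n) ≤ τ(n)²` (`τ₃(n) = Σ_{d∣n}τ(d)`, each `τ(d) ≤ τ(n)`). [folklore] -/
private theorem tau_three_le_sq (n : ℕ) : MeanSquareMajorant.tau 3 n ≤ (n.divisors.card : ℝ) ^ 2 := by
  rcases Nat.eq_zero_or_pos n with rfl | hn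
  · simp
  rw [MeanSquareMajorant.tau_succ_apply 2 n]
  calc ∑ d ∈ n.divisors, MeanSquareMajorant.tau 2 d ≤ ∑ _d ∈ n.divisors, (n.divisors.card : ℝ) :=
        Finset.sum_le_sum fun d hd => by
          rw [MeanSquareMajorant.tau_two_apply]
          exact_mod_cast card_divisors_le_of_dvd'' hn.ne' (Nat.dvd_of_mem_divisors hd)
    _ = (n.divisors.card : ℝ) ^ 2 := by rw [Finset.sum_const, nsmul_eq_mul, sq]

/-- **`|(ν∗χ)(n)| ≤ τ₃(n)`** (`(ν∗χ)(n) = Σ_{m∣n}χ(m)τ(m)`, `|χ| ≤ 1`, `τ₃(n) = Σ_{m∣n}τ(m)`).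
[cite: Zhang2022LandauSiegel, §16 (16.15) p.94] -/
theorem norm_nuConvChi_le_tau_three {D : ℕ} [NeZero D] (χ : DirichletCharacter ℂ D) (n : ℕ) :
    ‖nuConvChi χ n‖ ≤ MeanSquareMajorant.tau 3 n := by
  rcases Nat.eq_zero_or_pos n with rfl | hn
  · simp [nuConvChi]
  rw [nuConvChi_eq_sum_divisors χ hn, MeanSquareMajorant.tau_succ_apply 2 n]
  refine (norm_sum_le _ _).trans (Finset.sum_le_sum fun m _ => ?_)
  rw [norm_mul, Complex.norm_natCast, MeanSquareMajorant.tau_two_apply]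
  calc ‖χ (m : ZMod D)‖ * (m.divisors.card : ℝ) ≤ 1 * (m.divisors.card : ℝ) :=
        mul_le_mul_of_nonneg_right (DirichletCharacter.norm_le_one χ _) (Nat.cast_nonneg _)
    _ = (m.divisors.card : ℝ) := one_mul _

/-- **`|λ₂(d,1)| ≤ ∏_{q∣d}(q+1)/(q−1)`** (`λ₂(d,1) = ∏_{q∣d}(1 − χ(q)q^{−1−β₁})/(1 − χ(q)q^{−1})`,
`|numerator| ≤ 1 + 1/q`, `|denominator| ≥ 1 − 1/q`, `β₁ ∈ iℝ`). [cite: Zhang2022LandauSiegel, §16 p.90 (u014)] -/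
theorem norm_lam2_one_le_prod (c' : ℝ) {D : ℕ} [NeZero D] (χ : DirichletCharacter ℂ D) (d : ℕ) :
    ‖lam2 c' χ d 1‖ ≤ ∏ q ∈ d.primeFactors, ((q : ℝ) + 1) / ((q : ℝ) - 1) := by
  unfold lam2
  refine (Finset.norm_prod_le _ _).trans (Finset.prod_le_prod (fun q _ => norm_nonneg _) fun q hq => ?_)
  have hqp := Nat.prime_of_mem_primeFactors hq
  have hq2 : (2 : ℝ) ≤ q := by exact_mod_cast hqp.two_le
  have hq0 : (0 : ℝ) < q := by linarith
  have hχ : ‖χ (q : ZMod D)‖ ≤ 1 := DirichletCharacter.norm_le_one χ _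
  have hβre : (beta1 c' D).re = 0 := by rw [beta1_eq_b1_mul_I]; simp
  -- numerator
  have hnum : ‖1 - χ (q : ZMod D) * (q : ℂ) ^ (-(1 + beta1 c' D))‖ ≤ 1 + 1 / q := by
    have hpow : ‖(q : ℂ) ^ (-(1 + beta1 c' D))‖ = 1 / q := by
      rw [Complex.norm_natCast_cpow_of_pos hqp.pos, Complex.neg_re, Complex.add_re, Complex.one_re,
        hβre, add_zero, Real.rpow_neg_one, one_div]
    calc ‖1 - χ (q : ZMod D) * (q : ℂ) ^ (-(1 + beta1 c' D))‖
        ≤ ‖(1 : ℂ)‖ + ‖χ (q : ZMod D) * (q : ℂ) ^ (-(1 + beta1 c' D))‖ := norm_sub_le _ _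
      _ ≤ 1 + 1 * (1 / q) := by
          rw [norm_one, norm_mul, hpow]
          gcongr
      _ = 1 + 1 / q := by ring
  -- denominator
  have hden : 1 - 1 / (q : ℝ) ≤ ‖1 - χ (q : ZMod D) * (q : ℂ) ^ (-(1 : ℂ))‖ := by
    have hpow : ‖(q : ℂ) ^ (-(1 : ℂ))‖ = 1 / q := by
      rw [Complex.norm_natCast_cpow_of_pos hqp.pos, Complex.neg_re, Complex.one_re,
        Real.rpow_neg_one, one_div]
    have h1 : ‖χ (q : ZMod D) * (q : ℂ) ^ (-(1 : ℂ))‖ ≤ 1 / q := by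
      rw [norm_mul, hpow]
      calc ‖χ (q : ZMod D)‖ * (1 / (q : ℝ)) ≤ 1 * (1 / q) :=
            mul_le_mul_of_nonneg_right hχ (by positivity)
        _ = 1 / q := one_mul _
    calc 1 - 1 / (q : ℝ) ≤ ‖(1 : ℂ)‖ - ‖χ (q : ZMod D) * (q : ℂ) ^ (-(1 : ℂ))‖ := by
          rw [norm_one]; linarith
      _ ≤ ‖1 - χ (q : ZMod D) * (q : ℂ) ^ (-(1 : ℂ))‖ := norm_sub_norm_le _ _
  have hden0 : 0 < 1 - 1 / (q : ℝ) := by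
    rw [sub_pos, div_lt_one hq0]; linarith
  rw [norm_div]
  calc ‖1 - χ (q : ZMod D) * (q : ℂ) ^ (-(1 + beta1 c' D))‖ /
        ‖1 - χ (q : ZMod D) * (q : ℂ) ^ (-(1 : ℂ))‖
      ≤ (1 + 1 / q) / (1 - 1 / (q : ℝ)) := by
        calc _ ≤ ‖1 - χ (q : ZMod D) * (q : ℂ) ^ (-(1 + beta1 c' D))‖ / (1 - 1 / (q : ℝ)) :=
              div_le_div_of_nonneg_left (norm_nonneg _) hden0 hden
          _ ≤ (1 + 1 / q) / (1 - 1 / (q : ℝ)) := div_le_div_of_nonneg_right hnum hden0.le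
    _ = ((q : ℝ) + 1) / ((q : ℝ) - 1) := by
        field_simp

end Weights

/-! ## §2. The multiplicative majorant of `ϖ₂ⱼ(ν∗χ)` -/

section Majorant

/-- `⌈e^L⌉ ≤ D` gives `𝓛 ≥ L`. [folklore] -/
private theorem le_ell_of_ceil_exp_le'' {L : ℝ} {D : ℕ} (hD : ⌈Real.exp L⌉₊ ≤ D) : L ≤ ell D := by
  have h1 : Real.exp L ≤ D := le_trans (Nat.le_ceil _) (by exact_mod_cast hD)
  have hD0 : (0 : ℝ) < D := lt_of_lt_of_le (Real.exp_pos L) h1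
  rw [ell, Real.le_log_iff_exp_le hD0]
  exact h1

/-- The prime set `{p ≤ ⌊x⌋ : p prime}` in the two forms used by Shiu's packaged theorem
(`(Icc 1 ⌊x⌋).filter Prime`) and by the tree's Mertens sum (`Nat.primesLE ⌊x⌋`). [folklore] -/
private theorem filter_prime_Icc_eq_primesLE (N : ℕ) :
    (Finset.Icc 1 N).filter Nat.Prime = Nat.primesLE N := by
  ext p
  simp only [Finset.mem_filter, Finset.mem_Icc, Nat.primesLE, Nat.mem_primesBelow]
  constructor
  · rintro ⟨⟨-, h2⟩, hp⟩; exact ⟨by omega, hp⟩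
  · rintro ⟨h1, hp⟩; exact ⟨⟨hp.one_lt.le, by omega⟩, hp⟩

/-- **Mertens' second theorem, upper form**: `Σ_{p≤x} 1/p ≤ log log x + (M + 8)` for `x ≥ 3`
(`M` = the Meissel–Mertens constant; tree `abs_primeRecipSum_sub_le`: `|Σ_{p≤x}1/p − log log x − M| ≤
8/log x`, and `log x ≥ 1`). [cite: HardyWright2008, Theorem 427] -/
theorem sum_primes_inv_le {x : ℝ} (hx : 3 ≤ x) :
    ∑ p ∈ (Finset.Icc 1 ⌊x⌋₊).filter Nat.Prime, (1 : ℝ) / p ≤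
      Real.log (Real.log x) + (Mertens.meisselMertens + 8) := by
  have h := Mertens.abs_primeRecipSum_sub_le (show (2 : ℝ) ≤ x by linarith)
  have hlog : 1 ≤ Real.log x := by
    rw [Real.le_log_iff_exp_le (by linarith)]
    exact le_trans (le_of_lt (lt_trans Real.exp_one_lt_d9 (by norm_num))) hx
  have h8 : 8 / Real.log x ≤ 8 := div_le_self (by norm_num) hlog
  have hsum : ∑ p ∈ (Finset.Icc 1 ⌊x⌋₊).filter Nat.Prime, (1 : ℝ) / p = Mertens.primeRecipSum x := by
    rw [Mertens.primeRecipSum, filter_prime_Icc_eq_primesLE]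
    simp_rw [one_div]
  rw [hsum]
  have := (abs_le.mp h).2
  linarith

/-- The prime-value algebra of the majorant: for `p ≥ 2`, `t ≥ 1`,
`(1 + 900/(p/t))·(1 + (p+1)/(p−1))·3/p ≤ 6/p + 10812·t/p²` (`= 6(p+900t)/(p(p−1))` on the left).
[folklore] -/
private theorem prime_term_le {p t : ℝ} (hp : 2 ≤ p) (ht : 1 ≤ t) :
    (1 + 900 / (p / t)) * ((1 + (p + 1) / (p - 1)) * 3) / p ≤
      6 * (1 / p) + 10812 * (t / (p * p)) := by
  have hp0 : 0 < p := by linarith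
  have hp1 : 0 < p - 1 := by linarith
  have hL : (1 + 900 / (p / t)) * ((1 + (p + 1) / (p - 1)) * 3) / p =
      6 * (p + 900 * t) / (p * (p - 1)) := by
    field_simp
    ring
  have hR : 6 * (1 / p) + 10812 * (t / (p * p)) = (6 * p + 10812 * t) / (p * p) := by
    field_simp
  rw [hL, hR, div_le_iff₀ (by positivity), div_mul_eq_mul_div, le_div_iff₀ (by positivity)]
  nlinarith [mul_nonneg (sub_nonneg.mpr ht) (sub_nonneg.mpr hp), mul_pos hp0 hp1]

/-- **A multiplicative Shiu majorant for `ϖ₂ⱼ(ν∗χ)`.** There are a multiplicative `h : ℕ → ℝ≥0`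
(`h(n) = ∏_{q∣n}(1+900q^{−9/10})·Σ_{d∣n}∏_{q∣d}(q+1)/(q−1)·τ₃(n)`), a function `A₂` and a constant
`C₁`, all independent of the modulus, with: `h(p^l) ≤ 28832^l` (`l ≥ 1`); `h(n) ≤ A₂(δ)n^δ` (`δ > 0`,
`n ≥ 1`); `Σ_{p≤x}h(p)/p ≤ 6 log log x + C₁` (`x ≥ 3`); and — whenever `|𝓜₂*(s)| ≥ c₀ > 0` on
`|s−1| < 5α` and `|β_j| < 5α` — `|ϖ₂ⱼ(n)(ν∗χ)(n)| ≤ (K/c₀)h(n)` for `n ≥ 1`, `K = exp(225Σ'_q q^{−19/10})`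
the constant of u022. [cite: Zhang2022LandauSiegel, §16 pp.93–94 (u030, u040)] -/
theorem exists_multiplicative_majorant (c' : ℝ) :
    ∃ (h : ℕ → ℝ) (A₂ : ℝ → ℝ) (C₁ : ℝ),
      (∀ n, 0 ≤ h n) ∧
      (∀ m n : ℕ, m.Coprime n → h (m * n) = h m * h n) ∧
      (∀ p l : ℕ, p.Prime → 1 ≤ l → h (p ^ l) ≤ (28832 : ℝ) ^ l) ∧
      (∀ δ : ℝ, 0 < δ → ∀ n : ℕ, 1 ≤ n → h n ≤ A₂ δ * (n : ℝ) ^ δ) ∧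
      (∀ x : ℝ, 3 ≤ x → ∑ p ∈ (Finset.Icc 1 ⌊x⌋₊).filter Nat.Prime, h p / p ≤
          ((5 : ℕ) + 1 : ℝ) * Real.log (Real.log x) + C₁) ∧
      (∀ {D : ℕ} [NeZero D] (χ : DirichletCharacter ℂ D) {c₀ : ℝ}, 0 < c₀ →
        (∀ s : ℂ, ‖s - 1‖ < 5 * alpha D → c₀ ≤ ‖calM2star c' χ s‖) →
        ∀ {j : ℕ}, ‖betaJ c' D j‖ < 5 * alpha D → ∀ n : ℕ, 1 ≤ n →
          ‖varpi2 c' χ j n * nuConvChi χ n‖ ≤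
            Real.exp (225 * ∑' q : Nat.Primes, ((q : ℕ) : ℝ) ^ (-(19 / 10 : ℝ))) / c₀ * h n) := by
  classical
  -- the three multiplicative factors
  obtain ⟨W, hW⟩ : ∃ W : ArithmeticFunction ℝ,
      W = prodPrimeFactors (fun q : ℕ => 1 + 900 / (q : ℝ) ^ (9 / 10 : ℝ)) := ⟨_, rfl⟩
  obtain ⟨LP, hLP⟩ : ∃ LP : ArithmeticFunction ℝ,
      LP = prodPrimeFactors (fun q : ℕ => ((q : ℝ) + 1) / ((q : ℝ) - 1)) := ⟨_, rfl⟩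
  obtain ⟨H, hH⟩ : ∃ H : ArithmeticFunction ℝ,
      H = W.pmul ((LP * (ArithmeticFunction.zeta : ArithmeticFunction ℝ)).pmul
        (MeanSquareMajorant.tau 3)) := ⟨_, rfl⟩
  have hWmul : W.IsMultiplicative := by rw [hW]; exact ArithmeticFunction.IsMultiplicative.prodPrimeFactors _
  have hLPmul : LP.IsMultiplicative := by rw [hLP]; exact ArithmeticFunction.IsMultiplicative.prodPrimeFactors _
  have hLZmul : (LP * (ArithmeticFunction.zeta : ArithmeticFunction ℝ)).IsMultiplicative :=
    hLPmul.mul ArithmeticFunction.isMultiplicative_zeta.natCast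
  have hHmul : H.IsMultiplicative := by
    rw [hH]; exact hWmul.pmul (hLZmul.pmul (MeanSquareMajorant.isMultiplicative_tau 3))
  -- values
  have hWapp : ∀ {n : ℕ}, n ≠ 0 → W n = ∏ q ∈ n.primeFactors, (1 + 900 / (q : ℝ) ^ (9 / 10 : ℝ)) :=
    fun hn => by rw [hW, prodPrimeFactors_apply hn]
  have hLPapp : ∀ {n : ℕ}, n ≠ 0 → LP n = ∏ q ∈ n.primeFactors, ((q : ℝ) + 1) / ((q : ℝ) - 1) :=
    fun hn => by rw [hLP, prodPrimeFactors_apply hn]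
  have hLZapp : ∀ n : ℕ, (LP * (ArithmeticFunction.zeta : ArithmeticFunction ℝ)) n =
      ∑ d ∈ n.divisors, LP d := fun n => coe_mul_zeta_apply
  have hHapp : ∀ n : ℕ, H n = W n * ((∑ d ∈ n.divisors, LP d) * MeanSquareMajorant.tau 3 n) := by
    intro n; rw [hH, pmul_apply, pmul_apply, hLZapp]
  -- nonnegativity of the pieces
  have hW0 : ∀ n, 0 ≤ W n := by
    intro n
    rcases eq_or_ne n 0 with rfl | hn
    · simp
    · rw [hWapp hn]; exact Finset.prod_nonneg fun q _ => by positivity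
  have hW1 : ∀ {n : ℕ}, n ≠ 0 → 1 ≤ W n := by
    intro n hn
    rw [hWapp hn]
    calc (1 : ℝ) = ∏ _q ∈ n.primeFactors, (1 : ℝ) := Finset.prod_const_one.symm
      _ ≤ ∏ q ∈ n.primeFactors, (1 + 900 / (q : ℝ) ^ (9 / 10 : ℝ)) :=
          Finset.prod_le_prod (fun _ _ => zero_le_one) fun q _ => by
            have : 0 ≤ 900 / (q : ℝ) ^ (9 / 10 : ℝ) := by positivity
            linarith
  have hLP0 : ∀ n, 0 ≤ LP n := by
    intro n
    rcases eq_or_ne n 0 with rfl | hn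
    · simp
    · rw [hLPapp hn]; exact prod_primeFactors_lamPlus_nonneg n
  have hLZ0 : ∀ n : ℕ, 0 ≤ ∑ d ∈ n.divisors, LP d := fun n => Finset.sum_nonneg fun d _ => hLP0 d
  have hτ0 : ∀ n, 0 ≤ MeanSquareMajorant.tau 3 n := fun n => MeanSquareMajorant.tau_nonneg 3 n
  have hH0 : ∀ n, 0 ≤ H n := fun n => by rw [hHapp]; exact mul_nonneg (hW0 n) (mul_nonneg (hLZ0 n) (hτ0 n))
  -- the divisor bound, packaged as `A₂`
  obtain ⟨A₂, hA₂⟩ : ∃ A₂ : ℝ → ℝ, ∀ δ : ℝ, 0 < δ →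
      ∀ n : ℕ, n ≠ 0 → (n.divisors.card : ℝ) ^ 15 ≤ A₂ δ * (n : ℝ) ^ δ := by
    refine ⟨fun δ => if hδ : 0 < δ then
      (Classical.choose (Literature.NumberTheory.Sieve.exists_card_divisors_le_mul_rpow
        (show 0 < δ / 15 by positivity))) ^ 15 else 0, fun δ hδ n hn => ?_⟩
    simp only [dif_pos hδ]
    obtain ⟨hC1, hC⟩ := Classical.choose_spec
      (Literature.NumberTheory.Sieve.exists_card_divisors_le_mul_rpow (show 0 < δ / 15 by positivity))
    set C := Classical.choose
      (Literature.NumberTheory.Sieve.exists_card_divisors_le_mul_rpow (show 0 < δ / 15 by positivity))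
    have hnR : (0 : ℝ) < n := by exact_mod_cast Nat.pos_of_ne_zero hn
    calc (n.divisors.card : ℝ) ^ 15 ≤ (C * (n : ℝ) ^ (δ / 15)) ^ 15 :=
          pow_le_pow_left₀ (Nat.cast_nonneg _) (hC n hn) 15
      _ = C ^ 15 * (n : ℝ) ^ δ := by
          rw [mul_pow, ← Real.rpow_natCast ((n : ℝ) ^ (δ / 15)) 15, ← Real.rpow_mul hnR.le]
          norm_num
  -- the tail constant of the prime sum
  have htail_summ : Summable fun n : ℕ => (10812 : ℝ) * (n : ℝ) ^ (-(19 / 10 : ℝ)) :=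
    (Real.summable_nat_rpow.mpr (by norm_num)).mul_left _
  refine ⟨⇑H, A₂, 6 * (Mertens.meisselMertens + 8) +
      ∑' n : ℕ, (10812 : ℝ) * (n : ℝ) ^ (-(19 / 10 : ℝ)),
    hH0, fun m n hmn => hHmul.map_mul_of_coprime hmn, ?_, ?_, ?_, ?_⟩
  · -- prime powers: `h(p^l) = W(p)·(1 + l·LP(p))·τ₃(p^l) ≤ 901·4^l·8^l`
    intro p l hp hl
    have hl0 : l ≠ 0 := by omega
    have hp2 : (2 : ℝ) ≤ p := by exact_mod_cast hp.two_le
    have hpl0 : p ^ l ≠ 0 := pow_ne_zero _ hp.ne_zero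
    have hWpl : W (p ^ l) ≤ 901 := by
      rw [hWapp hpl0, Nat.primeFactors_prime_pow hl0 hp, Finset.prod_singleton]
      have h1 : (1 : ℝ) ≤ (p : ℝ) ^ (9 / 10 : ℝ) := Real.one_le_rpow (by linarith) (by norm_num)
      have : 900 / (p : ℝ) ^ (9 / 10 : ℝ) ≤ 900 := by
        rw [div_le_iff₀ (by linarith)]; nlinarith
      linarith
    have hLZpl : ∑ d ∈ (p ^ l).divisors, LP d ≤ 1 + 3 * l := by
      rw [Nat.sum_divisors_prime_pow hp, Finset.sum_range_succ']
      simp only [pow_zero]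
      rw [hLPmul.map_one]
      have hterm : ∀ i ∈ Finset.range l, LP (p ^ (i + 1)) ≤ 3 := by
        intro i _
        rw [hLPapp (pow_ne_zero _ hp.ne_zero), Nat.primeFactors_prime_pow (Nat.succ_ne_zero i) hp,
          Finset.prod_singleton]
        exact lamPlus_le_three hp.two_le
      calc ∑ i ∈ Finset.range l, LP (p ^ (i + 1)) + 1 ≤ ∑ _i ∈ Finset.range l, (3 : ℝ) + 1 := by
            gcongr with i hi
            exact hterm i hi
        _ = 1 + 3 * l := by rw [Finset.sum_const, Finset.card_range, nsmul_eq_mul]; ring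
    have hτpl : MeanSquareMajorant.tau 3 (p ^ l) ≤ ((l : ℝ) + 1) ^ 3 :=
      MeanSquareMajorant.tau_prime_pow_le 3 hp l
    have h4 : (1 : ℝ) + 3 * l ≤ 4 ^ l := by
      have := one_add_mul_le_pow (show (-2 : ℝ) ≤ 3 by norm_num) l
      norm_num at this
      linarith [this]
    have h2n : l + 1 ≤ 2 ^ l := (Nat.lt_two_pow_self : l < 2 ^ l)
    have h2 : (l : ℝ) + 1 ≤ 2 ^ l := by exact_mod_cast h2n
    have h8 : ((l : ℝ) + 1) ^ 3 ≤ 8 ^ l := by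
      calc ((l : ℝ) + 1) ^ 3 ≤ (2 ^ l) ^ 3 := pow_le_pow_left₀ (by positivity) h2 3
        _ = 8 ^ l := by rw [← pow_mul, mul_comm, pow_mul]; norm_num
    rw [hHapp]
    calc W (p ^ l) * ((∑ d ∈ (p ^ l).divisors, LP d) * MeanSquareMajorant.tau 3 (p ^ l))
        ≤ 901 * ((4 : ℝ) ^ l * 8 ^ l) := by
          refine mul_le_mul hWpl (mul_le_mul (hLZpl.trans h4) (hτpl.trans h8) (hτ0 _) (by positivity))
            (mul_nonneg (hLZ0 _) (hτ0 _)) (by norm_num)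
      _ ≤ 901 ^ l * ((4 : ℝ) ^ l * 8 ^ l) := by
          refine mul_le_mul_of_nonneg_right ?_ (by positivity)
          calc (901 : ℝ) = 901 ^ 1 := (pow_one _).symm
            _ ≤ 901 ^ l := pow_le_pow_right₀ (by norm_num) hl
      _ = 28832 ^ l := by rw [← mul_pow, ← mul_pow]; norm_num
  · -- polynomial growth: `h(n) ≤ τ(n)^{10}·τ(n)³·τ(n)² ≤ A₂(δ) n^δ`
    intro δ hδ n hn
    have hn0 : n ≠ 0 := by omega
    have hτ : (0 : ℝ) ≤ n.divisors.card := Nat.cast_nonneg _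
    have hWn : W n ≤ (n.divisors.card : ℝ) ^ 10 := by
      rw [hWapp hn0]; exact prod_primeFactors_weight_le hn0
    have hLZn : ∑ d ∈ n.divisors, LP d ≤ (n.divisors.card : ℝ) ^ 3 := by
      calc ∑ d ∈ n.divisors, LP d ≤ ∑ _d ∈ n.divisors, (n.divisors.card : ℝ) ^ 2 :=
            Finset.sum_le_sum fun d hd => by
              have hd0 : d ≠ 0 := Nat.pos_of_mem_divisors hd |>.ne'
              rw [hLPapp hd0]
              exact (prod_primeFactors_lamPlus_le hd0).trans (pow_le_pow_left₀ (Nat.cast_nonneg _)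
                (by exact_mod_cast card_divisors_le_of_dvd'' hn0 (Nat.dvd_of_mem_divisors hd)) 2)
        _ = (n.divisors.card : ℝ) ^ 3 := by rw [Finset.sum_const, nsmul_eq_mul]; ring
    have hτn : MeanSquareMajorant.tau 3 n ≤ (n.divisors.card : ℝ) ^ 2 := tau_three_le_sq n
    rw [hHapp]
    calc W n * ((∑ d ∈ n.divisors, LP d) * MeanSquareMajorant.tau 3 n)
        ≤ (n.divisors.card : ℝ) ^ 10 * ((n.divisors.card : ℝ) ^ 3 * (n.divisors.card : ℝ) ^ 2) :=
          mul_le_mul hWn (mul_le_mul hLZn hτn (hτ0 _) (by positivity)) (mul_nonneg (hLZ0 _) (hτ0 _))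
            (by positivity)
      _ = (n.divisors.card : ℝ) ^ 15 := by ring
      _ ≤ A₂ δ * (n : ℝ) ^ δ := hA₂ δ hδ n hn0
  · -- the prime sum: `h(p)/p = 6(1 + 900p^{−9/10})/(p−1) ≤ 6/p + 10812 p^{−19/10}`
    intro x hx
    have hterm : ∀ p ∈ (Finset.Icc 1 ⌊x⌋₊).filter Nat.Prime,
        H p / p ≤ 6 * (1 / p) + 10812 * (p : ℝ) ^ (-(19 / 10 : ℝ)) := by
      intro p hp
      have hpp : p.Prime := (Finset.mem_filter.mp hp).2
      have hp2 : (2 : ℝ) ≤ p := by exact_mod_cast hpp.two_le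
      have hp0 : (0 : ℝ) < p := by linarith
      have hWp : W p = 1 + 900 / (p : ℝ) ^ (9 / 10 : ℝ) := by
        rw [hWapp hpp.ne_zero, hpp.primeFactors, Finset.prod_singleton]
      have hLZp : ∑ d ∈ p.divisors, LP d = 1 + ((p : ℝ) + 1) / ((p : ℝ) - 1) := by
        rw [hpp.divisors, Finset.sum_pair hpp.one_lt.ne, hLPmul.map_one, hLPapp hpp.ne_zero,
          hpp.primeFactors, Finset.prod_singleton]
      have hτp : MeanSquareMajorant.tau 3 p = 3 := by
        rw [MeanSquareMajorant.tau_prime 3 hpp]; norm_num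
      rw [hHapp, hWp, hLZp, hτp]
      -- `t = p^{1/10} ≥ 1`, `p^{9/10} = p/t`, `p^{-19/10} = t/p²`
      have ht1 : (1 : ℝ) ≤ (p : ℝ) ^ (1 / 10 : ℝ) := Real.one_le_rpow (by linarith) (by norm_num)
      have hr : (p : ℝ) ^ (9 / 10 : ℝ) = p / (p : ℝ) ^ (1 / 10 : ℝ) := by
        rw [eq_div_iff (by positivity), ← Real.rpow_add hp0]
        norm_num
      have hr2 : (p : ℝ) ^ (-(19 / 10 : ℝ)) = (p : ℝ) ^ (1 / 10 : ℝ) / ((p : ℝ) * p) := by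
        rw [eq_div_iff (by positivity), show (p : ℝ) * p = (p : ℝ) ^ (2 : ℝ) by
          rw [Real.rpow_two, sq], ← Real.rpow_add hp0]
        norm_num
      rw [hr, hr2]
      exact prime_term_le hp2 ht1
    have hsplit : ∑ p ∈ (Finset.Icc 1 ⌊x⌋₊).filter Nat.Prime, H p / p ≤
        6 * ∑ p ∈ (Finset.Icc 1 ⌊x⌋₊).filter Nat.Prime, (1 : ℝ) / p +
          ∑ p ∈ (Finset.Icc 1 ⌊x⌋₊).filter Nat.Prime, 10812 * (p : ℝ) ^ (-(19 / 10 : ℝ)) := by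
      rw [Finset.mul_sum, ← Finset.sum_add_distrib]
      exact Finset.sum_le_sum hterm
    have htail : ∑ p ∈ (Finset.Icc 1 ⌊x⌋₊).filter Nat.Prime, 10812 * (p : ℝ) ^ (-(19 / 10 : ℝ)) ≤
        ∑' n : ℕ, (10812 : ℝ) * (n : ℝ) ^ (-(19 / 10 : ℝ)) :=
      htail_summ.sum_le_tsum _ fun n _ => by positivity
    have hM := sum_primes_inv_le hx
    push_cast
    linarith
  · -- the pointwise majorization
    intro D _ χ c₀ hc₀ hM j hβ n hn
    have hn0 : n ≠ 0 := by omega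
    set K : ℝ := Real.exp (225 * ∑' q : Nat.Primes, ((q : ℕ) : ℝ) ^ (-(19 / 10 : ℝ))) with hK
    have hK0 : 0 ≤ K := (Real.exp_pos _).le
    have hs : ‖(1 - betaJ c' D j) - 1‖ < 5 * alpha D := by rwa [sub_sub_cancel_left, norm_neg]
    have hMs : c₀ ≤ ‖calM2star c' χ (1 - betaJ c' D j)‖ := hM _ hs
    have hβre : (betaJ c' D j).re = 0 := by
      unfold betaJ
      split_ifs <;> simp [beta1_eq_b1_mul_I, beta2_eq_b2_mul_I, beta3_eq_b3_mul_I]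
    have hre : 9 / 10 < (1 - betaJ c' D j).re := by
      rw [Complex.sub_re, Complex.one_re, hβre]; norm_num
    -- `|ϖ₂ⱼ(n)| ≤ (K/c₀)·W(n)·Σ_{d∣n}LP(d)`
    have hϖ : ‖varpi2 c' χ j n‖ ≤ K / c₀ * (W n * ∑ d ∈ n.divisors, LP d) := by
      have hterm : ∀ x ∈ n.divisorsAntidiagonal,
          ‖lam2 c' χ x.1 1 * (x.1 : ℂ) ^ betaJ c' D j * χ (x.2 : ZMod D) *
              calM2 c' χ x.1 x.2 (1 - betaJ c' D j) / calM2star c' χ (1 - betaJ c' D j)‖ ≤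
            K / c₀ * W n * LP x.1 := by
        intro x hx
        obtain ⟨hprod, _⟩ := Nat.mem_divisorsAntidiagonal.mp hx
        have hx1 : 0 < x.1 := Nat.pos_of_ne_zero fun h => hn0 (by rw [← hprod, h, zero_mul])
        have hx2 : 0 < x.2 := Nat.pos_of_ne_zero fun h => hn0 (by rw [← hprod, h, mul_zero])
        have h1 : ‖lam2 c' χ x.1 1‖ ≤ LP x.1 := by
          rw [hLPapp hx1.ne']; exact norm_lam2_one_le_prod c' χ x.1
        have h2 : ‖(x.1 : ℂ) ^ betaJ c' D j‖ = 1 := by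
          rw [Complex.norm_natCast_cpow_of_pos hx1, hβre, Real.rpow_zero]
        have h3 : ‖χ (x.2 : ZMod D)‖ ≤ 1 := DirichletCharacter.norm_le_one χ _
        have h4 : ‖calM2 c' χ x.1 x.2 (1 - betaJ c' D j)‖ ≤ K * W n := by
          refine (norm_calM2_le c' χ hx1 hx2 hre).trans (le_of_eq ?_)
          rw [hprod, hWapp hn0]
        rw [norm_div, norm_mul, norm_mul, norm_mul, h2, mul_one]
        have hnum : ‖lam2 c' χ x.1 1‖ * ‖χ (x.2 : ZMod D)‖ *
            ‖calM2 c' χ x.1 x.2 (1 - betaJ c' D j)‖ ≤ LP x.1 * (K * W n) := by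
          calc _ ≤ LP x.1 * 1 * (K * W n) :=
                mul_le_mul (mul_le_mul h1 h3 (norm_nonneg _) (hLP0 _)) h4 (norm_nonneg _)
                  (mul_nonneg (hLP0 _) zero_le_one)
            _ = LP x.1 * (K * W n) := by ring
        calc _ ≤ ‖lam2 c' χ x.1 1‖ * ‖χ (x.2 : ZMod D)‖ *
              ‖calM2 c' χ x.1 x.2 (1 - betaJ c' D j)‖ / c₀ :=
              div_le_div_of_nonneg_left (by positivity) hc₀ hMs
          _ ≤ LP x.1 * (K * W n) / c₀ := div_le_div_of_nonneg_right hnum hc₀.le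
          _ = K / c₀ * W n * LP x.1 := by ring
      unfold varpi2
      refine (norm_sum_le _ _).trans ((Finset.sum_le_sum hterm).trans (le_of_eq ?_))
      rw [← Finset.mul_sum, Nat.sum_divisorsAntidiagonal (fun a _ => LP a)]
      ring
    have hν : ‖nuConvChi χ n‖ ≤ MeanSquareMajorant.tau 3 n := norm_nuConvChi_le_tau_three χ n
    rw [norm_mul, hHapp]
    calc ‖varpi2 c' χ j n‖ * ‖nuConvChi χ n‖
        ≤ (K / c₀ * (W n * ∑ d ∈ n.divisors, LP d)) * MeanSquareMajorant.tau 3 n :=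
          mul_le_mul hϖ hν (norm_nonneg _) (by
            exact mul_nonneg (div_nonneg hK0 hc₀.le) (mul_nonneg (hW0 _) (hLZ0 _)))
      _ = K / c₀ * (W n * ((∑ d ∈ n.divisors, LP d) * MeanSquareMajorant.tau 3 n)) := by ring

end Majorant

/-! ## §3. The first equality of (16.u040) with the error `O(𝓛⁻⁴)` -/

section U040a

/-- `e²·𝓛³⁰ ≤ e^𝓛 ≤ T = e^{𝓛^{1.1}}` once `𝓛 ≥ 200` (`2 + 30 log 𝓛 ≤ 𝓛`). [folklore] -/
private theorem exp_two_mul_ell_pow_le_bigT {D : ℕ} (hℓ : 200 ≤ ell D) :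
    Real.exp 2 * ell D ^ 30 ≤ bigT D := by
  have hℓ0 : 0 < ell D := by linarith
  have hlog2 : Real.log 2 < 0.6931471808 := Real.log_two_lt_d9
  have hlog : Real.log (ell D) ≤ Real.log 64 + (ell D / 64 - 1) := by
    have h := Real.log_le_sub_one_of_pos (show 0 < ell D / 64 by positivity)
    rw [Real.log_div hℓ0.ne' (by norm_num)] at h
    linarith
  have h64 : Real.log 64 = 6 * Real.log 2 := by
    rw [show (64 : ℝ) = 2 ^ 6 by norm_num, Real.log_pow]; norm_num
  have hmain : 2 + 30 * Real.log (ell D) ≤ ell D := by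
    rw [h64] at hlog; nlinarith
  have hpow : ell D ^ 30 = Real.exp (30 * Real.log (ell D)) := by
    rw [← Real.rpow_natCast (ell D) 30, Real.rpow_def_of_pos hℓ0]
    congr 1; push_cast; ring
  have h1 : ell D ≤ ell D ^ (1.1 : ℝ) := by
    calc ell D = ell D ^ (1 : ℝ) := (Real.rpow_one _).symm
      _ ≤ ell D ^ (1.1 : ℝ) := Real.rpow_le_rpow_of_exponent_le (by linarith) (by norm_num)
  rw [hpow, ← Real.exp_add, bigT]
  exact Real.exp_le_exp.mpr (by linarith)

/-- **`Z22:§16.u040`, first equality, with the error `O(𝓛⁻⁴)`** (statement = `Step16_u040a c′` with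
`(ell D ^ 4)⁻¹` in place of `(ell D ^ 10)⁻¹`; this is the strength used by the consumer
`Typed.Section16B.sumLtT_eval_of_repair`): for `D` large under (A) and `j = 1, 2`,
`‖Σ_{1≤n<T} ϖ₂ⱼ(n)(ν∗χ)(n)/n − Σ_n ϖ₂ⱼ(n)(ν∗χ)(n)n⁻¹g(T/n)‖ ≤ C/𝓛⁴` — the multiplicative majorant of
`exists_multiplicative_majorant` fed to the tree's Shiu-packaged unsmoothing theorem
`GaussWeight.norm_sum_Ico_sub_tsum_mul_gWeight_le_of_multiplicative` (`X = T`, `Λ = 𝓛³⁰`, `k = 5`: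
error `≤ G·C·(log T)⁵/𝓛¹⁵ ≤ G·C·𝓛¹⁰/𝓛¹⁵ ≤ G·C/𝓛⁴`). [cite: Zhang2022LandauSiegel, §16 p.94 (u040)] -/
theorem step16_u040a_weak (c' : ℝ) :
    ∃ C : ℝ, ForAllLarge fun D _ χ => AssumptionA D χ → ∀ j ∈ ({1, 2} : Finset ℕ),
      ‖(∑ n ∈ Finset.Ico 1 ⌈bigT D⌉₊, varpi2 c' χ j n * nuConvChi χ n / (n : ℂ)) -
          ∑' n : ℕ, varpi2 c' χ j n * nuConvChi χ n / (n : ℂ) * (gW D (bigT D / n) : ℂ)‖ ≤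
        C * (ell D ^ 4)⁻¹ := by
  obtain ⟨h, A₂, C₁, h0, hmul, hpl, hA₂, hprime, hmaj⟩ := exists_multiplicative_majorant c'
  obtain ⟨C, X₀, hC, HH⟩ := GaussWeight.norm_sum_Ico_sub_tsum_mul_gWeight_le_of_multiplicative
    (A₁ := 28832) (by norm_num) A₂ 5 C₁
  obtain ⟨c₀, hc₀, D₀, hM⟩ := inline16_calM2starLarge_of_lemma161 c' (AppendixA.lemma161_holds c')
  set K : ℝ := Real.exp (225 * ∑' q : Nat.Primes, ((q : ℕ) : ℝ) ^ (-(19 / 10 : ℝ))) with hK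
  have hK0 : 0 < K := Real.exp_pos _
  have hG0 : 0 < K / c₀ := div_pos hK0 hc₀
  refine ⟨K / c₀ * C, max D₀ ⌈Real.exp (max (max 200 (Real.pi * (5 * |c'| + 1))) X₀)⌉₊,
    fun D _ χ hD hq hp hA j hj => ?_⟩
  have hD₀ : D₀ ≤ D := le_trans (le_max_left _ _) hD
  have hL := le_ell_of_ceil_exp_le'' (le_trans (le_max_right _ _) hD)
  have hℓ200 : 200 ≤ ell D := le_trans (le_trans (le_max_left _ _) (le_max_left _ _)) hL
  have hℓπ : Real.pi * (5 * |c'| + 1) ≤ ell D :=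
    le_trans (le_trans (le_max_right _ _) (le_max_left _ _)) hL
  have hX₀ℓ : X₀ ≤ ell D := le_trans (le_max_right _ _) hL
  have hℓ2 : 2 ≤ ell D := by linarith
  have hℓ1 : 1 ≤ ell D := by linarith
  have hℓ0 : 0 < ell D := by linarith
  -- the hypotheses of the packaged unsmoothing theorem at `X = T`, `Λ = 𝓛³⁰`
  have hT : bigT D = Real.exp (ell D ^ (1.1 : ℝ)) := rfl
  have h11 : ell D ≤ ell D ^ (1.1 : ℝ) := by
    calc ell D = ell D ^ (1 : ℝ) := (Real.rpow_one _).symm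
      _ ≤ ell D ^ (1.1 : ℝ) := Real.rpow_le_rpow_of_exponent_le hℓ1 (by norm_num)
  have hX : X₀ ≤ bigT D := by
    rw [hT]
    have := Real.add_one_le_exp (ell D ^ (1.1 : ℝ))
    linarith
  have hΛ4 : (4 : ℝ) ≤ ell D ^ 30 := le_trans (by norm_num) (pow_le_pow_left₀ (by norm_num) hℓ2 30)
  have hΛk : ((5 : ℕ) : ℝ) + 1 ≤ 2 * ell D ^ 30 := by push_cast; linarith
  have hΛX : Real.exp 2 * ell D ^ 30 ≤ bigT D := exp_two_mul_ell_pow_le_bigT hℓ200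
  -- the coefficients, divided by `G = K/c₀`
  have hβ : ‖betaJ c' D j‖ < 5 * alpha D := norm_betaJ_lt_five_alpha hℓ2 hℓπ hj
  have hmaj' := hmaj χ hc₀ (hM D χ hD₀ hq hp hA) hβ
  obtain ⟨-, hle⟩ := HH h h0 hmul hpl hA₂ hprime
    (fun n => varpi2 c' χ j n * nuConvChi χ n / (K / c₀ : ℝ)) (fun n hn => by
      rw [norm_div, Complex.norm_real, Real.norm_of_nonneg hG0.le, div_le_iff₀ hG0]
      calc ‖varpi2 c' χ j n * nuConvChi χ n‖ ≤ K / c₀ * h n := hmaj' n hn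
        _ = h n * (K / c₀) := mul_comm _ _)
    (bigT D) (ell D ^ 30) hX hΛ4 hΛk hΛX
  -- pull the factor `G` out
  have hGC : ((K / c₀ : ℝ) : ℂ) ≠ 0 := Complex.ofReal_ne_zero.mpr hG0.ne'
  have hsum_eq : (∑ n ∈ Finset.Ico 1 ⌈bigT D⌉₊, varpi2 c' χ j n * nuConvChi χ n / (n : ℂ)) =
      ((K / c₀ : ℝ) : ℂ) * ∑ n ∈ Finset.Ico 1 ⌈bigT D⌉₊,
        varpi2 c' χ j n * nuConvChi χ n / ((K / c₀ : ℝ) : ℂ) / (n : ℂ) := by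
    rw [Finset.mul_sum]
    refine Finset.sum_congr rfl fun n _ => ?_
    field_simp
  have htsum_eq : (∑' n : ℕ, varpi2 c' χ j n * nuConvChi χ n / (n : ℂ) * (gW D (bigT D / n) : ℂ)) =
      ((K / c₀ : ℝ) : ℂ) * ∑' n : ℕ, varpi2 c' χ j n * nuConvChi χ n / ((K / c₀ : ℝ) : ℂ) / (n : ℂ) *
        (GaussWeight.gWeight (ell D ^ 30) (bigT D / n) : ℂ) := by
    rw [← tsum_mul_left]
    refine tsum_congr fun n => ?_
    rw [gW]
    field_simp
  rw [hsum_eq, htsum_eq, ← mul_sub, norm_mul, Complex.norm_real, Real.norm_of_nonneg hG0.le,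
    mul_assoc]
  refine mul_le_mul_of_nonneg_left (hle.trans ?_) hG0.le
  -- `C (log T)^5 / √(𝓛³⁰) ≤ C/𝓛⁴`
  have hlogT : Real.log (bigT D) = ell D ^ (1.1 : ℝ) := by rw [hT, Real.log_exp]
  have hsqrt : Real.sqrt (ell D ^ 30) = ell D ^ 15 := by
    rw [show ell D ^ 30 = (ell D ^ 15) ^ 2 by ring, Real.sqrt_sq (by positivity)]
  have h12 : ell D ^ (1.1 : ℝ) ≤ ell D ^ 2 := by
    calc ell D ^ (1.1 : ℝ) ≤ ell D ^ (2 : ℝ) := Real.rpow_le_rpow_of_exponent_le hℓ1 (by norm_num)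
      _ = ell D ^ 2 := by norm_cast
  have h5 : Real.log (bigT D) ^ 5 ≤ ell D ^ 10 := by
    rw [hlogT]
    calc (ell D ^ (1.1 : ℝ)) ^ 5 ≤ (ell D ^ 2) ^ 5 :=
          pow_le_pow_left₀ (Real.rpow_nonneg hℓ0.le _) h12 5
      _ = ell D ^ 10 := by ring
  rw [hsqrt, div_le_iff₀ (by positivity)]
  calc C * Real.log (bigT D) ^ 5 ≤ C * ell D ^ 10 := mul_le_mul_of_nonneg_left h5 hC
    _ ≤ C * (ell D ^ 11) := mul_le_mul_of_nonneg_left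
        (pow_le_pow_right₀ hℓ1 (by norm_num)) hC
    _ = C * (ell D ^ 4)⁻¹ * ell D ^ 15 := by field_simp

end U040a

end Literature.NumberTheory.LFunctions.Zhang2022.Typed.Section16B
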